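import Literature.MathematicalPhysics.QuantumFieldTheory.Balaban1983to89.B9Eq342CovariantResolventAdjointRow
import Literature.MathematicalPhysics.QuantumFieldTheory.Balaban1983to89.B9Eq342GreenPrimeTowerSupBoundDecayCosh
import Literature.MathematicalPhysics.QuantumFieldTheory.Balaban1983to89.B9Eq373TransporterLipschitzLetters

/-!
# `Balaban1983to89.B9Eq342CovariantResolventAdjointRowTower` — T. Bałaban, *Propagators for lattice gauge theories in a background field*, Commun. Math. Phys. **99**
# (1985) 389–434 [Balaban1985BackgroundPropagators] Thm 3.1 (3.42) p. 397, THIRD ENTRY WITH ITS DECAY FACTOR, FOR THE COVARIANT MASSIVE RESOLVENT ON THE CELL's MODEL: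
# **`∃ αa Ba δa` BEFORE THE HEIGHT, THE VOLUME AND THE BACKGROUND such that at every height `n` (`ηL^{n+1} = 1`), every period `m`, every unitary background of
# the small-field class (`‖U(b) − 1‖ ≤ αη`, `‖U(x,μ) − U(x−e_μ,μ)‖ ≤ αη²`, `α ≤ αa`), ANY positivity witness, every bond datum `f` supported over ONE big block `v`
# with `‖f‖_∞ ≤ F`: `‖((Δ^η_U + 1)⁻¹D*_Uf)(x)‖ ≤ Ba·e^{−δa·d_m(Πx, v)}·F`** — the abstract weighted row `B9Eq342CovariantResolventAdjointRow.adjRow_covariantResolvent_half`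
# INSTANTIATED at the chain's transporters `R = R(U)`, `S = R(U⁻¹)` on the tower's fine torus `T_{(L^{n+1}m)}` (`t = η⁻¹ = L^{n+1}`, mass `1`, rate
# `a⋆ = √(1∕(4d(L^{n+1})² + 1))` of `B9Eq342GreenPrimeSupBoundDecayCosh.rate_explicit`, `ε = 2M_φM_φ′αη`, `ε′ = 2M_φM_φ′αη²` so that `tε = t²ε′ = 2M_φM_φ′α`), the
# `cosh` weight centred AT THE OUTPUT SITE converted to the block-distance decay (`B9Eq342GreenPrimeTowerSupBoundDecayCosh.exp_bigBlockDist_le_weight_site`), and the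
# flat constant bounded uniformly (`S_ad ≤ 16d`)

statement-level skeleton of published theorems with citation tags; proofs where landed; nothing here is a claim about the Yang–Mills mass gap

CITATION HEADER (lean-in-tree rule).  Audit cell `pub-balaban`, sub-cell `t4`, BINDER row NE9; filed by NE9 crux-team LEAF PROVER 01 (`b2b-balaban-t4-ne9-formalise-leaf-01`,
gen 93; bears_on: R4/N22).  Source READ first-hand (`paper:balaban1985-cmp99-background-propagators`, journal page = PDF page + 388): p. 397 Thm 3.1 *«There exist positive
constants M₁, δ₀, α₀, B₀ dependent on d and L only … for an arbitrary configuration U satisfying the regularity condition (3.35) with Mα₀ ≤ a₀ …»*, (3.42) third member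
`|(G′(U)∇*_Uλ)(x)| ≤ B₀L^jηe^{−δ₀d(y,y′)}|λ|`; p. 396 (3.35); p. 398 (gauge invariance; the random-walk proof — NOT reproduced).  Inputs BY NAME: this lineage's abstract row and
letters (`B9Eq342CovariantResolventAdjointRow(Letters)`, `B5Eq129FreeResolventWeightedAdjointRow`), the chain's transporter letters (`B9Eq342GreenPrimeSupBound.adTransportW_inv_adTransportW`,
`norm_adTransportW_eq`, `norm_adTransportW_inv_eq`; `B9Eq384RemainderLetters.norm_adTransportW_sub_le`; `B9Eq373TransporterLipschitzLetters.norm_adTransportW_inv_sub_adTransportW_inv_le`),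
the OWNER's rate and tower weight letters.  Nothing printed is a hypothesis; the `[cite: …]` tags are TEXT LOCATIONS.

WHAT IS PROVED (sorry-free; proof lane — 0 `def`).
* §0 `sad_le_sixteen_mul` — the flat constant `S_ad = t·Σ_νB_ν` of the weighted adjoint row at `t ≥ 1`, mass `1`, the rate `a⋆` and periods `P_ν ≥ t` is `≤ 16d`
  (`λ ≥ ½`, `a⋆t ≤ 1`, `sinh a ≤ a + a²∕2`).
* §1 **`exists_decayRow_resolvent_covDiv`** — THE DECAYED ADJOINT ROW OF `(Δ^η_U + 1)⁻¹D*_U` ON THE MODEL, `∃ αa Ba δa` FIRST (explicit: `αa = 1∕(128·2M_φM_φ′·d + 1)`,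
  `δa = √(1∕(4d+1))`, `Ba` a polynomial in `d` and `2M_φM_φ′`), quantifiers in the order of the (T4E) binder block restricted to the letters actually read
  (`ηL^{n+1} = 1`, unitarity∕trace∕fibre-norm compatibility, `U(b) ∈ U1`, `‖U(b) − 1‖ ≤ αη`, `‖U(x,μ) − U(x−e_μ,μ)‖ ≤ αη²`, any `hpos`).
HONEST SCOPE.  The MASSIVE resolvent `(Δ^η_U + 1)⁻¹` — the value member of (HLa₀) for print's `G′_k(U)` follows by `G′_kD*_U = G_1D*_U + G′_k[(1 − a′Q̃′†Q̃′)G_1D*_U]`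
with the OWNER's closed decayed value row (next file); no ∇-row, no Hölder row ((3.43)₂ and (3.44) stay the located open members of STOREY H).  Constants crude.  NOT summit
progress (cell pub-balaban: NE9 NOT PRINTED ∕ NOT PROVED; «NE9 ⇐ the named binders»; row WALLED ON A MODEL (O-NE9-1; #5 UNRULED); spine PROVED 0∕9; rung (B)+1 finite T⁴ — NOT
infinite volume, NOT mass gap, NOT BetaPertH, NOT Clay).  HONEST DEPENDENCY (cell line): continuum YM on T⁴ ⇐ BetaPertH ∧ nine spine estimates (0/9 proved); BetaPertH ⇐ (D1) ∧
(D4) ∧ CAP+tail; G-an2-4 gates asym, D1 and NE2/3/4.  NEW file; nothing modified.  Net new unproved facts: 0.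
-/

noncomputable section

open scoped InnerProductSpace ComplexConjugate BigOperators

namespace Literature.MathematicalPhysics.QuantumFieldTheory.Balaban1983to89.B9Eq342CovariantResolventAdjointRowTower

open B4Sect5Torus (TSite tdist tdist_nonneg)
open B4TorusKernel.MultiPeriod (circAbs)
open B7Prop1Explicit (U1 mem_U1 norm_inv_sub_one_le)
open B9SectCLatticeCarrier (Bond bpos btgt shift unshift)
open B9Eq311L2Pairing (WL2)
open B11Eq103H1Complex (SiteL2K BondL2K covDivL2K covLaplaceSiteK greenK)
open B9Eq310HessianOperator (adTransportW)
open B9Eq319QprimeTorus (fineP blockCoord)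
open B9Eq315QTower (towerP towerP_apply)
open B9Eq316TowerFlatIsOneStep (towerP_eq_fineP_pow siteCast)
open B9Eq342GreenPrimeSupBound (adTransportW_inv_adTransportW norm_adTransportW_eq norm_adTransportW_inv_eq)
open B9Eq384RemainderLetters (norm_adTransportW_sub_le)
open B9Eq373TransporterLipschitzLetters (norm_adTransportW_inv_sub_adTransportW_inv_le)
open B9Eq342GreenPrimeSupBoundDecayCosh (rate_explicit)
open B9Eq342GreenPrimeTowerSupBoundDecayCosh (exp_bigBlockDist_le_weight_site)
open B9Eq342CoshWeightSite (weight_site_centre weight_site_pos)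
open B9Eq342CovariantResolventAdjointRow (adjRow_covariantResolvent_half)

/-! ## §0 The flat constant is bounded uniformly in the height -/

/-- `sinh a ≤ a + a²∕2` on `[0,1]` (private twin of `B4StripCauchy.sinh_le_of_le_one`). [folklore] -/
private theorem sinh_le_of_le_one {a : ℝ} (h0 : 0 ≤ a) (h1 : a ≤ 1) : Real.sinh a ≤ a + a ^ 2 / 2 := by
  rw [Real.sinh_eq]
  have e1 : Real.exp a ≤ 1 + a + a ^ 2 := by
    have h := Real.abs_exp_sub_one_sub_id_le (x := a) (by rw [abs_of_nonneg h0]; exact h1)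
    have := (abs_le.mp h).2; linarith
  have e2 : 1 - a ≤ Real.exp (-a) := by have := Real.add_one_le_exp (-a); linarith
  linarith

/-- **`S_ad ≤ 16d` UNIFORMLY**: at mass `1`, `t ≥ 1`, a rate `0 ≤ a ≤ 1` with `a·t ≤ 1` and `½ ≤ 1 − 2d·t²(cosh a − 1)`, and periods `P_ν ≥ t`, the flat adjoint-row
constant `t·Σ_νB_ν` (`B5Eq129FreeResolventWeightedAdjointRow`) is at most `16d`: per direction `(1 + e^{−a})(1 + 2t∕(P_ν√μ))∕√(μ² + 4μt²) ≤ 10∕t` (`μ ≥ ½`, `√(μ² + 4μt²) ≥ t`)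
and `2 sinh a∕λ ≤ 6a ≤ 6∕t`. [folklore] [cite: Balaban1984PropagatorsI, (1.29) p.23, p.36; Balaban1985BackgroundPropagators, Thm 3.1 (3.42) p.397] -/
theorem sad_le_sixteen_mul {d : ℕ} (P : Fin d → ℕ) {t a : ℝ} (ht : 1 ≤ t) (ha0 : 0 ≤ a) (ha1 : a ≤ 1) (hat : a * t ≤ 1)
    (hlam : 1 / 2 ≤ 1 - 2 * (d : ℝ) * t ^ 2 * (Real.cosh a - 1)) (hP : ∀ ν, t ≤ (P ν : ℝ)) :
    t * ∑ ν : Fin d, ((1 + Real.exp (-a)) * ((1 + 2 * t / (P ν * Real.sqrt (1 - 2 * ((d : ℝ) - 1) * t ^ 2 * (Real.cosh a - 1)))) /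
            Real.sqrt ((1 - 2 * ((d : ℝ) - 1) * t ^ 2 * (Real.cosh a - 1)) ^ 2 + 4 * (1 - 2 * ((d : ℝ) - 1) * t ^ 2 * (Real.cosh a - 1)) * t ^ 2)) +
          2 * Real.sinh a / (1 - 2 * (d : ℝ) * t ^ 2 * (Real.cosh a - 1))) ≤ 16 * d := by
  have ht0 : 0 < t := by linarith
  have hc : 0 ≤ Real.cosh a - 1 := by linarith [Real.one_le_cosh a]
  set μ : ℝ := 1 - 2 * ((d : ℝ) - 1) * t ^ 2 * (Real.cosh a - 1) with hμdef
  set lam : ℝ := 1 - 2 * (d : ℝ) * t ^ 2 * (Real.cosh a - 1) with hlamdef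
  have hμlam : lam ≤ μ := by rw [hμdef, hlamdef]; nlinarith [sq_nonneg t]
  have hμ : 1 / 2 ≤ μ := hlam.trans hμlam
  have hμ0 : 0 < μ := by linarith
  -- `√μ ≥ ½`, `√(μ² + 4μt²) ≥ t`
  have hsμ : 1 / 2 ≤ Real.sqrt μ := by
    rw [Real.le_sqrt (by norm_num) hμ0.le]; nlinarith
  have hden : t ≤ Real.sqrt (μ ^ 2 + 4 * μ * t ^ 2) := by
    rw [Real.le_sqrt ht0.le (by positivity)]; nlinarith [sq_nonneg μ, sq_nonneg t]
  have hterm : ∀ ν : Fin d, (1 + Real.exp (-a)) * ((1 + 2 * t / (P ν * Real.sqrt μ)) / Real.sqrt (μ ^ 2 + 4 * μ * t ^ 2)) + 2 * Real.sinh a / lam ≤ 16 / t := by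
    intro ν
    have hPν : t ≤ (P ν : ℝ) := hP ν
    have hPs : t / 2 ≤ P ν * Real.sqrt μ := by nlinarith
    have h1 : 2 * t / (P ν * Real.sqrt μ) ≤ 4 := by
      rw [div_le_iff₀ (by nlinarith)]; nlinarith
    have h2 : (1 + 2 * t / (P ν * Real.sqrt μ)) / Real.sqrt (μ ^ 2 + 4 * μ * t ^ 2) ≤ 5 / t := by
      rw [div_le_div_iff₀ (by positivity) ht0]
      have h5 : 0 ≤ 1 + 2 * t / (P ν * Real.sqrt μ) := by positivity
      nlinarith
    have h3 : 1 + Real.exp (-a) ≤ 2 := by have := Real.exp_le_one_iff.mpr (neg_nonpos.mpr ha0); linarith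
    have h4 : (1 + Real.exp (-a)) * ((1 + 2 * t / (P ν * Real.sqrt μ)) / Real.sqrt (μ ^ 2 + 4 * μ * t ^ 2)) ≤ 2 * (5 / t) :=
      mul_le_mul h3 h2 (by positivity) zero_le_two
    have h5 : Real.sinh a ≤ 3 / 2 * a := by
      have := sinh_le_of_le_one ha0 ha1; nlinarith
    have h6 : 2 * Real.sinh a / lam ≤ 6 / t := by
      rw [div_le_div_iff₀ (by linarith) ht0]
      have hs0 : 0 ≤ Real.sinh a := Real.sinh_nonneg_iff.mpr ha0
      nlinarith
    calc _ ≤ 2 * (5 / t) + 6 / t := add_le_add h4 h6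
      _ = 16 / t := by ring
  calc t * ∑ ν : Fin d, ((1 + Real.exp (-a)) * ((1 + 2 * t / (P ν * Real.sqrt μ)) / Real.sqrt (μ ^ 2 + 4 * μ * t ^ 2)) + 2 * Real.sinh a / lam)
      ≤ t * ∑ _ν : Fin d, 16 / t := mul_le_mul_of_nonneg_left (Finset.sum_le_sum fun ν _ => hterm ν) ht0.le
    _ = 16 * d := by rw [Finset.sum_const, Finset.card_univ, Fintype.card_fin, nsmul_eq_mul]; field_simp

/-- arithmetic of the smallness `κ ≤ ½` (outside the big context). [folklore] -/
private theorem kappa_le_half {c α d S ea : ℝ} (hc0 : 0 ≤ c) (hα : 0 ≤ α) (hα1 : α * (128 * c * d + 1) ≤ 1) (hd0 : 0 ≤ d) (_hS0 : 0 ≤ S)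
    (hS : S ≤ 16 * d) (hea0 : 0 ≤ ea) (hea : ea ≤ 3) : c * α * S * (ea + 1) ≤ 1 / 2 := by
  have h1 : c * α * S * (ea + 1) ≤ c * α * (16 * d) * 4 :=
    mul_le_mul (mul_le_mul_of_nonneg_left hS (mul_nonneg hc0 hα)) (by linarith) (by linarith) (by positivity)
  have h2 : c * α * d ≤ 1 / 128 := by nlinarith [mul_nonneg (mul_nonneg hc0 hα) hd0]
  linarith

/-- arithmetic of the constant `A ≤ A⋆` (outside the big context). [folklore] -/
private theorem A_le_Astar {c α d S ea li : ℝ} (hc0 : 0 ≤ c) (hα : 0 ≤ α) (hα1 : α ≤ 1) (hd0 : 0 ≤ d) (_hS0 : 0 ≤ S) (hS : S ≤ 16 * d)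
    (hea0 : 0 ≤ ea) (hea : ea ≤ 3) (hli0 : 0 ≤ li) (hli : li ≤ 2) :
    2 * (S * (1 + li * (d * ((c * α) ^ 2 * ea + c * α))) + li * (c * α * d * ea)) ≤ 2 * (16 * d * (1 + 2 * d * (3 * c ^ 2 + c)) + 6 * c * d) := by
  have hcα0 : 0 ≤ c * α := mul_nonneg hc0 hα
  have hcα1 : c * α ≤ c := (mul_le_mul_of_nonneg_left hα1 hc0).trans_eq (mul_one c)
  have h1 : (c * α) ^ 2 * ea + c * α ≤ 3 * c ^ 2 + c := by
    have : (c * α) ^ 2 ≤ c ^ 2 := pow_le_pow_left₀ hcα0 hcα1 2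
    nlinarith
  have h2 : li * (d * ((c * α) ^ 2 * ea + c * α)) ≤ 2 * (d * (3 * c ^ 2 + c)) :=
    mul_le_mul hli (mul_le_mul_of_nonneg_left h1 hd0) (by positivity) zero_le_two
  have h3 : li * (c * α * d * ea) ≤ 2 * (c * d * 3) := by
    refine mul_le_mul hli ?_ (by positivity) zero_le_two
    calc c * α * d * ea = (c * α) * (d * ea) := by ring
      _ ≤ c * (d * ea) := mul_le_mul_of_nonneg_right hcα1 (mul_nonneg hd0 hea0)
      _ = c * d * ea := by ring
      _ ≤ c * d * 3 := mul_le_mul_of_nonneg_left hea (mul_nonneg hc0 hd0)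
  have h4 : S * (1 + li * (d * ((c * α) ^ 2 * ea + c * α))) ≤ 16 * d * (1 + 2 * (d * (3 * c ^ 2 + c))) :=
    mul_le_mul hS (by linarith) (by positivity) (by positivity)
  nlinarith

/-! ## §1 The decayed adjoint row of the covariant massive resolvent on the model -/

variable {d : ℕ} (L : ℕ) [NeZero L] (hL3 : 3 ≤ L)
  {𝔸 : Type*} [NormedRing 𝔸] [NormedAlgebra ℂ 𝔸] [NormOneClass 𝔸] [StarRing 𝔸]
  {W : Type*} [NormedAddCommGroup W] [InnerProductSpace ℂ W] [FiniteDimensional ℂ W] (φ : W ≃ₗ[ℂ] 𝔸)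
  {Mφ Mφ' : ℝ} (hMφ : 0 ≤ Mφ) (hMφ' : 0 ≤ Mφ') (hφ : ∀ w, ‖φ w‖ ≤ Mφ * ‖w‖) (hφ' : ∀ X, ‖φ.symm X‖ ≤ Mφ' * ‖X‖)
  (τ : 𝔸 →ₗ[ℂ] ℂ) (hτ₂ : ∀ X Y : 𝔸, τ (X * Y) = τ (Y * X)) (hφτ : ∀ X Y : 𝔸, ⟪φ.symm X, φ.symm Y⟫_ℂ = τ (star X * Y))
set_option maxHeartbeats 400000 in
include hL3 hMφ hMφ' hφ hφ' hτ₂ hφτ in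
/-- **[B9] Thm 3.1 (3.42), THIRD ENTRY WITH DECAY, FOR `(Δ^η_U + 1)⁻¹D*_U` ON THE MODEL — `∃ αa Ba δa` BEFORE THE HEIGHT.**  For `L ≥ 3`, a fibre `W ≃ 𝔸` with norm letters
`M_φ, M_φ′` and a trace compatible with the fibre norm: there are `αa > 0`, `Ba ≥ 0`, `δa > 0` such that at every height `n`, `ηL^{n+1} = 1`, every weight `c₀`, every period
`m`, every background `U` on the bonds of `T_{(L^{n+1}m)}` with `U(b)* = U(b)⁻¹`, `U(b) ∈ U1`, `‖U(b) − 1‖ ≤ αη`, `‖U(x,μ) − U(x−e_μ,μ)‖ ≤ αη²` (`0 ≤ α ≤ αa`), ANY positivity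
witness `hpos` of `Δ^η_U + 1`, every big block `v`, every bond datum `f` supported in `Π⁻¹(v)` with `‖f(b)‖ ≤ F` (`F ≥ 0`) and every fine site `x`:
`‖((Δ^η_U + 1)⁻¹D*_Uf)(x)‖ ≤ Ba·e^{−δa·d_m(Πx, v)}·F`. [cite: Balaban1985BackgroundPropagators, Thm 3.1 (3.42) p.397, (3.35) p.396, (3.23) p.394, (3.8) p.392] -/
theorem exists_decayRow_resolvent_covDiv (hd : 1 ≤ d) :
    ∃ αa Ba δa : ℝ, 0 < αa ∧ 0 ≤ Ba ∧ 0 < δa ∧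
      ∀ (n : ℕ) (η : ℝ) (_hηL : η * (L : ℝ) ^ (n + 1) = 1) (c₀ : ℝ) [Fact (0 < c₀)] (m : Fin d → ℕ) [∀ i, NeZero (m i)]
        (U : Bond d (towerP L m (n + 1)) → 𝔸ˣ) (α : ℝ) (_hα : 0 ≤ α) (_hαle : α ≤ αa)
        (_hUst : ∀ b, star (U b : 𝔸) = (((U b)⁻¹ : 𝔸ˣ) : 𝔸)) (_hUb : ∀ b, U b ∈ U1 𝔸) (_hUη : ∀ b, ‖(U b : 𝔸) - 1‖ ≤ α * η)
        (_hUgrad : ∀ (x : TSite d (towerP L m (n + 1))) (μ : Fin d), ‖(U (x, μ) : 𝔸) - U (unshift μ x, μ)‖ ≤ α * η ^ 2)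
        (hpos : ∀ x : SiteL2K ℂ d (towerP L m (n + 1)) c₀ W, x ≠ 0 →
          0 < RCLike.re ⟪x, ((covLaplaceSiteK (c₀ := c₀) ((η : ℂ))⁻¹ (adTransportW φ U) (adTransportW φ fun b => (U b)⁻¹) + (1 : ℂ) • LinearMap.id :
            SiteL2K ℂ d (towerP L m (n + 1)) c₀ W →ₗ[ℂ] SiteL2K ℂ d (towerP L m (n + 1)) c₀ W)) x⟫_ℂ)
        (v : TSite d m) (f : BondL2K ℂ d (towerP L m (n + 1)) c₀ W) (F : ℝ) (_hF : 0 ≤ F)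
        (_hfv : ∀ b, blockCoord (L ^ (n + 1)) m (siteCast (towerP_eq_fineP_pow L m (n + 1)) (bpos b)) ≠ v →
          WL2.equiv ℂ (fun _ : Bond d (towerP L m (n + 1)) => c₀) W f b = 0)
        (_hfF : ∀ b, ‖WL2.equiv ℂ (fun _ : Bond d (towerP L m (n + 1)) => c₀) W f b‖ ≤ F) (x : TSite d (towerP L m (n + 1))),
        ‖WL2.equiv ℂ (fun _ : TSite d (towerP L m (n + 1)) => c₀) W
            (greenK _ hpos (covDivL2K ℂ c₀ ((η : ℂ))⁻¹ (adTransportW φ fun b => (U b)⁻¹) f)) x‖ ≤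
          Ba * Real.exp (-(δa * tdist m (blockCoord (L ^ (n + 1)) m (siteCast (towerP_eq_fineP_pow L m (n + 1)) x)) v)) * F := by
  -- the constants
  set c : ℝ := 2 * Mφ * Mφ' with hc
  have hc0 : 0 ≤ c := by positivity
  set Astar : ℝ := 16 * d * (1 + 2 * d * (3 * c ^ 2 + c)) + 6 * c * d with hAstar
  have hAstar0 : 0 ≤ Astar := by positivity
  refine ⟨1 / (128 * c * d + 1), 12 * Astar, Real.sqrt (1 / (4 * d + 1)), by positivity, by positivity, Real.sqrt_pos.2 (by positivity), ?_⟩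
  intro n η hηL c₀ _ m _ U α hα hαle hUst hUb hUη hUgrad hpos v f F hF hfv hfF x
  -- the scale letters
  have hK1 : (1 : ℝ) ≤ (L : ℝ) ^ (n + 1) := one_le_pow₀ (by exact_mod_cast (by omega : 1 ≤ L))
  have hK0 : (0 : ℝ) < (L : ℝ) ^ (n + 1) := by linarith
  have hη0 : 0 < η := by
    rcases lt_trichotomy η 0 with h | h | h
    · nlinarith
    · rw [h, zero_mul] at hηL; exact absurd hηL zero_ne_one
    · exact h
  have hηK : η⁻¹ = (L : ℝ) ^ (n + 1) := inv_eq_of_mul_eq_one_right hηL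
  have hηt : η * η⁻¹ = 1 := mul_inv_cancel₀ hη0.ne'
  have hm1 : ∀ i, 1 ≤ m i := fun i => Nat.one_le_iff_ne_zero.mpr (NeZero.ne (m i))
  have hP : ∀ ν : Fin d, η⁻¹ ≤ (towerP L m (n + 1) ν : ℝ) := fun ν => by
    rw [hηK, towerP_apply, Nat.cast_mul, Nat.cast_pow]
    exact le_mul_of_one_le_right hK0.le (by exact_mod_cast hm1 ν)
  have hn2 : ∀ ν : Fin d, 2 ≤ towerP L m (n + 1) ν := fun ν => by
    rw [towerP_apply]
    calc 2 ≤ L ^ 1 * 1 := by rw [pow_one, mul_one]; omega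
      _ ≤ L ^ (n + 1) * m ν := Nat.mul_le_mul (Nat.pow_le_pow_right (by omega) (by omega)) (hm1 ν)
  -- the rate
  obtain ⟨ha0, ha1, hlam, haK⟩ := rate_explicit (d := d) η⁻¹ 1 one_pos (by rw [hηK]; exact hK1)
  set a : ℝ := Real.sqrt (1 / (4 * d * η⁻¹ ^ 2 + 1)) with ha_def
  have hd1 : (1 : ℝ) ≤ d := by exact_mod_cast hd
  have hat : a * η⁻¹ ≤ 1 := by
    have h2 : (a * η⁻¹) ^ 2 ≤ 1 := by
      rw [mul_pow, ha_def, Real.sq_sqrt (by positivity), div_mul_eq_mul_div, one_mul, div_le_one (by positivity)]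
      nlinarith [sq_nonneg (η⁻¹), mul_le_mul_of_nonneg_right hd1 (sq_nonneg (η⁻¹))]
    nlinarith [mul_nonneg ha0.le (inv_pos.2 hη0).le]
  have hlam' : 2 * (d : ℝ) * η⁻¹ ^ 2 * (Real.cosh a - 1) < 1 := by linarith
  have hea : Real.exp a ≤ 3 := (Real.exp_le_exp.2 ha1).trans (by have := Real.exp_one_lt_d9; linarith)
  -- the transporter letters
  have hUbinv : ∀ b, (U b)⁻¹ ∈ U1 𝔸 := fun b => by
    have h := mem_U1.1 (hUb b); rw [mem_U1, inv_inv]; exact ⟨h.2, h.1⟩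
  have hRε : ∀ b w, ‖adTransportW φ U b w - w‖ ≤ c * (α * η) * ‖w‖ := fun b w => by
    have h := norm_adTransportW_sub_le φ hφ hφ' hMφ' U b (hUb b) (hUη b) w; rw [hc]; linarith
  have hSε : ∀ b w, ‖adTransportW φ (fun bb => (U bb)⁻¹) b w - w‖ ≤ c * (α * η) * ‖w‖ := fun b w => by
    have h := norm_adTransportW_sub_le φ hφ hφ' hMφ' (fun bb => (U bb)⁻¹) b (hUbinv b) ((norm_inv_sub_one_le (hUb b)).trans (hUη b)) w
    rw [hc]; linarith
  have hSε' : ∀ (y : TSite d (towerP L m (n + 1))) (μ : Fin d) (w : W),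
      ‖adTransportW φ (fun bb => (U bb)⁻¹) (y, μ) w - adTransportW φ (fun bb => (U bb)⁻¹) (unshift μ y, μ) w‖ ≤ c * (α * η ^ 2) * ‖w‖ := fun y μ w => by
    have h := norm_adTransportW_inv_sub_adTransportW_inv_le φ hφ hφ' hMφ' U U (y, μ) (unshift μ y, μ) (hUb _) (hUb _) w
    have h2 : 2 * Mφ * Mφ' * ‖(U (y, μ) : 𝔸) - (U (unshift μ y, μ) : 𝔸)‖ * ‖w‖ ≤ c * (α * η ^ 2) * ‖w‖ := by
      rw [hc]; exact mul_le_mul_of_nonneg_right (mul_le_mul_of_nonneg_left (hUgrad y μ) (by positivity)) (norm_nonneg w)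
    exact h.trans h2
  -- the flat constant, the smallness `κ ≤ ½` and the size of `A` (scalars only)
  have hSad := sad_le_sixteen_mul (towerP L m (n + 1)) (t := η⁻¹) (a := a) (by rw [hηK]; exact hK1) ha0.le ha1 hat hlam hP
  have hSad0 := B9Eq342CovariantResolventAdjointRow.sad_nonneg (P := towerP L m (n + 1)) η⁻¹ (inv_pos.2 hη0) (m := 1) ha0.le hlam' _ rfl
  have htε : η⁻¹ * (c * (α * η)) = c * α := by field_simp
  have htε' : η⁻¹ ^ 2 * (c * (α * η ^ 2)) = c * α := by field_simp
  have hd0 : (0 : ℝ) ≤ d := Nat.cast_nonneg d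
  have hα1 : α * (128 * c * d + 1) ≤ 1 := (le_div_iff₀ (by positivity)).1 hαle
  have hαa1 : α ≤ 1 := by nlinarith [mul_nonneg (mul_nonneg hc0 hα) hd0]
  have hκ : η⁻¹ * (c * (α * η)) * (η⁻¹ * ∑ ν : Fin d, ((1 + Real.exp (-a)) * ((1 + 2 * η⁻¹ / (towerP L m (n + 1) ν * Real.sqrt (1 - 2 * ((d : ℝ) - 1) * η⁻¹ ^ 2 * (Real.cosh a - 1)))) /
            Real.sqrt ((1 - 2 * ((d : ℝ) - 1) * η⁻¹ ^ 2 * (Real.cosh a - 1)) ^ 2 + 4 * (1 - 2 * ((d : ℝ) - 1) * η⁻¹ ^ 2 * (Real.cosh a - 1)) * η⁻¹ ^ 2)) +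
          2 * Real.sinh a / (1 - 2 * (d : ℝ) * η⁻¹ ^ 2 * (Real.cosh a - 1)))) * (Real.exp a + 1) ≤ 1 / 2 := by
    rw [htε]; exact kappa_le_half hc0 hα hα1 hd0 hSad0 hSad (Real.exp_pos a).le hea
  have hlam2 : (1 - 2 * (d : ℝ) * η⁻¹ ^ 2 * (Real.cosh a - 1))⁻¹ ≤ 2 := by
    rw [inv_le_comm₀ (by linarith) two_pos]; linarith
  have hA : 2 * ((η⁻¹ * ∑ ν : Fin d, ((1 + Real.exp (-a)) * ((1 + 2 * η⁻¹ / (towerP L m (n + 1) ν * Real.sqrt (1 - 2 * ((d : ℝ) - 1) * η⁻¹ ^ 2 * (Real.cosh a - 1)))) /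
            Real.sqrt ((1 - 2 * ((d : ℝ) - 1) * η⁻¹ ^ 2 * (Real.cosh a - 1)) ^ 2 + 4 * (1 - 2 * ((d : ℝ) - 1) * η⁻¹ ^ 2 * (Real.cosh a - 1)) * η⁻¹ ^ 2)) +
          2 * Real.sinh a / (1 - 2 * (d : ℝ) * η⁻¹ ^ 2 * (Real.cosh a - 1)))) * (1 + (1 - 2 * (d : ℝ) * η⁻¹ ^ 2 * (Real.cosh a - 1))⁻¹ * (η⁻¹ ^ 2 * d * ((c * (α * η)) ^ 2 * Real.exp a + c * (α * η ^ 2)))) +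
      (1 - 2 * (d : ℝ) * η⁻¹ ^ 2 * (Real.cosh a - 1))⁻¹ * (η⁻¹ * (c * (α * η)) * d * Real.exp a)) ≤ 2 * Astar := by
    have e1 : η⁻¹ ^ 2 * d * ((c * (α * η)) ^ 2 * Real.exp a + c * (α * η ^ 2)) = d * ((c * α) ^ 2 * Real.exp a + c * α) := by
      have h1 : η⁻¹ ^ 2 * (c * (α * η)) ^ 2 = (c * α) ^ 2 := by rw [← htε]; ring
      calc η⁻¹ ^ 2 * d * ((c * (α * η)) ^ 2 * Real.exp a + c * (α * η ^ 2))
          = d * ((η⁻¹ ^ 2 * (c * (α * η)) ^ 2) * Real.exp a + η⁻¹ ^ 2 * (c * (α * η ^ 2))) := by ring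
        _ = d * ((c * α) ^ 2 * Real.exp a + c * α) := by rw [h1, htε']
    rw [e1, htε, hAstar]
    exact A_le_Astar hc0 hα hαa1 hd0 hSad0 hSad (Real.exp_pos a).le hea (by positivity) hlam2
  -- the data in the weighted currency centred at `x`
  set D : ℝ := tdist m (blockCoord (L ^ (n + 1)) m (siteCast (towerP_eq_fineP_pow L m (n + 1)) x)) v with hD
  have hD0 : 0 ≤ D := tdist_nonneg m _ _
  set Fx : ℝ := 2 * Real.exp (a * ((L : ℝ) ^ (n + 1) - 1)) * Real.exp (-(a * (L : ℝ) ^ (n + 1) * D)) * F with hFx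
  have hFx0 : 0 ≤ Fx := by positivity
  have hdata : ∀ b : Bond d (towerP L m (n + 1)), ‖WL2.equiv ℂ _ W f b‖ ≤ Fx * ∏ μ, Real.cosh (a * (circAbs (towerP L m (n + 1) μ)
      ((((x μ : ℕ) : ZMod (towerP L m (n + 1) μ)) - ((bpos b μ : ℕ) : ZMod (towerP L m (n + 1) μ))).val) : ℝ)) := fun b => by
    by_cases hb : blockCoord (L ^ (n + 1)) m (siteCast (towerP_eq_fineP_pow L m (n + 1)) (bpos b)) = v
    · have hW := exp_bigBlockDist_le_weight_site L m n ha0.le x (bpos b)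
      rw [hb, ← hD] at hW
      refine (hfF b).trans ?_
      have hpos3 : 0 < Real.exp (a * ((L : ℝ) ^ (n + 1) - 1)) * 2 := by positivity
      calc F = Fx * (Real.exp (a * (L : ℝ) ^ (n + 1) * D) / (Real.exp (a * ((L : ℝ) ^ (n + 1) - 1)) * 2)) := by
            rw [hFx, Real.exp_neg]; field_simp
        _ ≤ Fx * _ := mul_le_mul_of_nonneg_left ((div_le_iff₀' hpos3).2 hW) hFx0
    · rw [hfv b hb, norm_zero]; positivity
  -- `2A·Fx ≤ 12A⋆·e^{−δa D}·F` (scalars only)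
  have hexp1 : Real.exp (a * ((L : ℝ) ^ (n + 1) - 1)) ≤ 3 := by
    have e : a * ((L : ℝ) ^ (n + 1) - 1) = a * η⁻¹ - a := by rw [← hηK]; ring
    have h1 : a * ((L : ℝ) ^ (n + 1) - 1) ≤ 1 := by rw [e]; linarith [ha0.le]
    exact (Real.exp_le_exp.2 h1).trans (by have := Real.exp_one_lt_d9; linarith)
  have hexp2 : Real.exp (-(a * (L : ℝ) ^ (n + 1) * D)) ≤ Real.exp (-(Real.sqrt (1 / (4 * d + 1)) * D)) := by
    rw [Real.exp_le_exp, neg_le_neg_iff, ← hηK]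
    exact mul_le_mul_of_nonneg_right (by simpa using haK) hD0
  have hfin : 2 * ((η⁻¹ * ∑ ν : Fin d, ((1 + Real.exp (-a)) * ((1 + 2 * η⁻¹ / (towerP L m (n + 1) ν * Real.sqrt (1 - 2 * ((d : ℝ) - 1) * η⁻¹ ^ 2 * (Real.cosh a - 1)))) /
            Real.sqrt ((1 - 2 * ((d : ℝ) - 1) * η⁻¹ ^ 2 * (Real.cosh a - 1)) ^ 2 + 4 * (1 - 2 * ((d : ℝ) - 1) * η⁻¹ ^ 2 * (Real.cosh a - 1)) * η⁻¹ ^ 2)) +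
          2 * Real.sinh a / (1 - 2 * (d : ℝ) * η⁻¹ ^ 2 * (Real.cosh a - 1)))) * (1 + (1 - 2 * (d : ℝ) * η⁻¹ ^ 2 * (Real.cosh a - 1))⁻¹ * (η⁻¹ ^ 2 * d * ((c * (α * η)) ^ 2 * Real.exp a + c * (α * η ^ 2)))) +
      (1 - 2 * (d : ℝ) * η⁻¹ ^ 2 * (Real.cosh a - 1))⁻¹ * (η⁻¹ * (c * (α * η)) * d * Real.exp a)) * Fx ≤
      12 * Astar * Real.exp (-(Real.sqrt (1 / (4 * d + 1)) * D)) * F := by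
    refine (mul_le_mul_of_nonneg_right hA hFx0).trans ?_
    rw [hFx]
    calc 2 * Astar * (2 * Real.exp (a * ((L : ℝ) ^ (n + 1) - 1)) * Real.exp (-(a * (L : ℝ) ^ (n + 1) * D)) * F)
        = 2 * Astar * 2 * F * (Real.exp (a * ((L : ℝ) ^ (n + 1) - 1)) * Real.exp (-(a * (L : ℝ) ^ (n + 1) * D))) := by ring
      _ ≤ 2 * Astar * 2 * F * (3 * Real.exp (-(Real.sqrt (1 / (4 * d + 1)) * D))) :=
          mul_le_mul_of_nonneg_left (mul_le_mul hexp1 hexp2 (Real.exp_pos _).le (by norm_num)) (by positivity)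
      _ = 12 * Astar * Real.exp (-(Real.sqrt (1 / (4 * d + 1)) * D)) * F := by ring
  -- THE ABSTRACT ROW, instantiated (centre := the output site `x`)
  have hmain := adjRow_covariantResolvent_half (P := towerP L m (n + 1)) (c₀ := c₀) (W := W) η⁻¹ (inv_pos.2 hη0) (m := 1) (a := a)
    (ε := c * (α * η)) (ε' := c * (α * η ^ 2)) one_pos ha0.le (by positivity) (by positivity) hlam' hn2
    (adTransportW φ U) (adTransportW φ fun b => (U b)⁻¹) (fun b w => adTransportW_inv_adTransportW φ U b w)
    (fun b w => (norm_adTransportW_eq φ U τ hτ₂ hUst hφτ b w).le) (fun b w => (norm_adTransportW_inv_eq φ U τ hτ₂ hUst hφτ b w).le)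
    hRε hSε hSε'
    (fun x₀ y => ∏ μ, Real.cosh (a * (circAbs (towerP L m (n + 1) μ)
      ((((x₀ μ : ℕ) : ZMod (towerP L m (n + 1) μ)) - ((y μ : ℕ) : ZMod (towerP L m (n + 1) μ))).val) : ℝ))) (fun _ _ => rfl) _ rfl
    ((covLaplaceSiteK (c₀ := c₀) ((η : ℂ))⁻¹ (adTransportW φ U) (adTransportW φ fun b => (U b)⁻¹) + (1 : ℂ) • LinearMap.id :
      SiteL2K ℂ d (towerP L m (n + 1)) c₀ W →ₗ[ℂ] SiteL2K ℂ d (towerP L m (n + 1)) c₀ W))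
    (by rw [Complex.ofReal_inv, Complex.ofReal_one]) hpos hκ x f Fx hFx0 hdata x
  rw [weight_site_centre (towerP L m (n + 1)) a x, mul_one, Complex.ofReal_inv] at hmain
  exact hmain.trans hfin

end Literature.MathematicalPhysics.QuantumFieldTheory.Balaban1983to89.B9Eq342CovariantResolventAdjointRowTower

end
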